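import Mathlib
import Summits.PneNP.PneNP.Theorems.OverlapGapAlgebraSolvableImpliesStableSectionMeanSquareTransfer
import Summits.PneNP.PneNP.Theorems.OverlapGapAlgebraSearchHardWindowTwoRoundLocal

/-!
# PneNP / OverlapGapAlgebra — `SearchHardWindow` / `SolvableImpliesStableSection`:
# TWO-ROUND LOCAL RULES are ℓ²-stable (2/2) — the rung with a rate and the transfer

Support for cruxes `stmt-PneNP-2460` and `stmt-PneNP-2463`. Consequences of
`…SearchHardWindowTwoRoundLocal` for the def-free class of TWO-ROUND LOCAL search maps (hypothesis
`hloc`: the output bit at `v` is any label-dependent function of the labelled clauses that `v` sees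
within two rounds):

* `shwLoc_twoRound_meanSquare` — such a map has mean-square single-literal-resample sensitivity at most
  `s₂(n) = (2k + k²(6 log n + 1))² + 1` (`m ≤ αn`, `e^{αke²} ≤ n³`);
* `shwLoc_isLittleO` — `s₂(n) log³ n = O(log⁵ n) = o(n)`;
* `shwLoc_twoRoundLocalMapsFail_rate` — UNCONDITIONALLY, for `k ≥ k₀` there is `C > 0` with: eventually
  in `n`, every two-round local map on `F_k(n, ⌊α_k n⌋)`, `α_k = 5·2^k log k/k`, solves at most a
  `C log⁴ n / n` fraction of the instances (`shwMSR_successCount_le_rate`);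
* `shwLoc_twoRound_stableSection_of_solvable` — at every `(k ≥ 1, α, η, ν)`: if two-round local maps
  solve `F_k(n, ⌊αn⌋)` with probability `≥ ε` infinitely often, the conclusion of
  `SolvableImpliesStableSection` holds for every `c > 0` (`sissMS_concl_of_meanSquareStableSolver`).
So the abstract ℓ²-stable theorems bite on a recognisable algorithm class (majority / threshold votes,
one or two rounds of parallel local repair, unit-clause-style local guesses, …) with no hypothesis left.
No new definitions; axioms `propext`, `Classical.choice`, `Quot.sound`.
-/

set_option linter.dupNamespace false -- `Summit.PneNP.PneNP.…`: summit = sub-problem (D-0017)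

namespace Summit.PneNP.PneNP.Theorems

open Finset Filter Asymptotics
open scoped Classical

section TwoRoundRung

variable {m k n : ℕ}

/-- **Two-round local rules are ℓ²-stable.** If `1 ≤ n`, `m ≤ αn` and `e^{αke²} ≤ n³`, a two-round
local map `g` has `∑_{(a,b)} ∑_{(Φ,ℓ)} d_H(g Φ, g Φ[(a,b) ↦ ℓ])² ≤ ((2k + k²(6 log n + 1))² + 1)·(m k)·#Inst·2n`. -/
theorem shwLoc_twoRound_meanSquare (hn : 1 ≤ n) (α : ℝ) (hα : 0 ≤ α) (hm : (m : ℝ) ≤ α * n)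
    (hlarge : Real.exp (α * k * Real.exp 2) ≤ (n : ℝ) ^ 3)
    (g : (Fin m → Fin k → Fin n × Bool) → (Fin n → Bool))
    (hloc : ∀ (Φ Φ' : Fin m → Fin k → Fin n × Bool) (v : Fin n),
      (∀ i : Fin m,
        ((∃ j : Fin k, ((Φ i j).1 = v ∨
            ∃ i' : Fin m, (∃ j', (Φ i' j').1 = v) ∧ ∃ j', (Φ i' j').1 = (Φ i j).1)) ∨
         (∃ j : Fin k, ((Φ' i j).1 = v ∨
            ∃ i' : Fin m, (∃ j', (Φ' i' j').1 = v) ∧ ∃ j', (Φ' i' j').1 = (Φ' i j).1))) →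
        Φ i = Φ' i) →
      g Φ v = g Φ' v) :
    (∑ a : Fin m, ∑ b : Fin k, ∑ p : (Fin m → Fin k → Fin n × Bool) × (Fin n × Bool),
        (hammingDist (g p.1) (g (Function.update p.1 a (Function.update (p.1 a) b p.2))) : ℝ) ^ 2)
      ≤ ((2 * k + k * k * (6 * Real.log n + 1)) ^ 2 + 1)
          * (((m * k : ℕ) : ℝ) * (Fintype.card (Fin m → Fin k → Fin n × Bool) * (2 * n))) := by
  refine shwLoc_meanSquare_of_typLipschitz hn α hα hm hlarge g (2 * k + k * k * (6 * Real.log n + 1)) ?_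
  intro Φ hΦ a b ℓ
  have h := shwLoc_hamming_update_le g hloc Φ a b ℓ
  have hk0 : (0 : ℝ) ≤ k * k := by positivity
  have hmono : (k : ℝ) * k * (2 * (((univ : Finset (Fin n)).sup fun v =>
      ((univ : Finset (Fin m)).filter fun i => ∃ j, (Φ i j).1 = v).card : ℕ) : ℝ) + 1)
      ≤ k * k * (6 * Real.log n + 1) :=
    mul_le_mul_of_nonneg_left (by linarith only [hΦ]) hk0
  linarith only [h, hmono]

/-- The sensitivity scale of two-round local rules is admissible:
`((2k + k²(6 log n + 1))² + 1) · log³ n = O(log⁵ n) = o(n)`. -/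
theorem shwLoc_isLittleO (k : ℕ) :
    (fun n : ℕ => ((2 * k + k * k * (6 * Real.log n + 1)) ^ 2 + 1) * Real.log n ^ 3)
      =o[atTop] (fun n : ℕ => (n : ℝ)) := by
  have h1 : (fun n : ℕ => Real.log n ^ 5) =o[atTop] (fun n : ℕ => (n : ℝ)) := by
    have := (Real.isLittleO_pow_log_id_atTop (n := 5)).comp_tendsto tendsto_natCast_atTop_atTop
    simpa [Function.comp_def] using this
  have hk0 : (0 : ℝ) ≤ k := Nat.cast_nonneg _
  set K : ℝ := (2 * k + 7 * (k * k)) ^ 2 + 1 with hK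
  have h2 : (fun n : ℕ => ((2 * k + k * k * (6 * Real.log n + 1)) ^ 2 + 1) * Real.log n ^ 3)
      =O[atTop] (fun n : ℕ => Real.log n ^ 5) := by
    refine IsBigO.of_bound K ?_
    filter_upwards [eventually_ge_atTop 3] with n hn
    have hn3 : (3 : ℝ) ≤ n := by exact_mod_cast hn
    have hL1 : 1 ≤ Real.log n := by
      rw [← Real.log_exp 1]
      apply Real.log_le_log (Real.exp_pos 1)
      have : Real.exp 1 ≤ 3 := le_of_lt (lt_trans Real.exp_one_lt_d9 (by norm_num))
      exact this.trans hn3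
    have hL0 : 0 ≤ Real.log n := by linarith only [hL1]
    set L := Real.log n with hL
    have hbase0 : 0 ≤ 2 * k + k * k * (6 * L + 1) := by positivity
    have hbase : 2 * k + k * k * (6 * L + 1) ≤ (2 * k + 7 * (k * k)) * L := by
      have : 0 ≤ (2 * k + k * k) * (L - 1) := mul_nonneg (by positivity) (by linarith only [hL1])
      nlinarith only [this]
    have hsq : (2 * k + k * k * (6 * L + 1)) ^ 2 ≤ ((2 * k + 7 * (k * k)) * L) ^ 2 :=
      pow_le_pow_left₀ hbase0 hbase 2
    have hL2 : 1 ≤ L ^ 2 := one_le_pow₀ hL1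
    have hval : ((2 * k + k * k * (6 * L + 1)) ^ 2 + 1) * L ^ 3 ≤ K * L ^ 5 := by
      have h3 : 0 ≤ L ^ 3 := by positivity
      calc ((2 * k + k * k * (6 * L + 1)) ^ 2 + 1) * L ^ 3
          ≤ (((2 * k + 7 * (k * k)) * L) ^ 2 + L ^ 2) * L ^ 3 := by
            apply mul_le_mul_of_nonneg_right _ h3
            linarith only [hsq, hL2]
        _ = K * L ^ 5 := by rw [hK]; ring
    have hlhs0 : 0 ≤ ((2 * k + k * k * (6 * L + 1)) ^ 2 + 1) * L ^ 3 := by positivity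
    rw [Real.norm_eq_abs, Real.norm_eq_abs, abs_of_nonneg hlhs0, abs_of_nonneg (by positivity)]
    exact hval
  exact h2.trans_isLittleO h1

/-- **Two-round local rules fail in the Bresler–Huang window, with a polynomial rate (unconditional).**
For all `k ≥ k₀` there is `C > 0` such that, eventually in `n`, every two-round local search map on
`F_k(n, ⌊α_k n⌋)`, `α_k = 5·2^k log k/k`, solves at most a `C log⁴ n / n` fraction of the instances. -/
theorem shwLoc_twoRoundLocalMapsFail_rate :
    ∃ k₀ : ℕ, ∀ k : ℕ, k₀ ≤ k → ∃ C : ℝ, 0 < C ∧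
      ∀ᶠ n : ℕ in atTop, ∀ m : ℕ, m = ⌊5 * 2 ^ k * Real.log k / k * n⌋₊ →
        ∀ g : (Fin m → Fin k → Fin n × Bool) → (Fin n → Bool),
          (∀ (Φ Φ' : Fin m → Fin k → Fin n × Bool) (v : Fin n),
            (∀ i : Fin m,
              ((∃ j : Fin k, ((Φ i j).1 = v ∨
                  ∃ i' : Fin m, (∃ j', (Φ i' j').1 = v) ∧ ∃ j', (Φ i' j').1 = (Φ i j).1)) ∨
               (∃ j : Fin k, ((Φ' i j).1 = v ∨
                  ∃ i' : Fin m, (∃ j', (Φ' i' j').1 = v) ∧ ∃ j', (Φ' i' j').1 = (Φ' i j).1))) →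
              Φ i = Φ' i) →
            g Φ v = g Φ' v) →
          ((Finset.univ.filter fun Φ : Fin m → Fin k → Fin n × Bool =>
              ∀ i, ∃ j, g Φ (Φ i j).1 = (Φ i j).2).card : ℝ)
            ≤ C * Real.log n ^ 4 / n * Fintype.card (Fin m → Fin k → Fin n × Bool) := by
  obtain ⟨k₀, h⟩ := shwMSR_successCount_le_rate
  refine ⟨k₀, fun k hk => ?_⟩
  obtain ⟨C₀, hC₀, hmain⟩ := h k hk
  have hk0 : (0 : ℝ) ≤ k := Nat.cast_nonneg _
  set K : ℝ := (2 * k + 7 * (k * k)) ^ 2 + 2 with hK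
  have hKpos : 0 < K := by rw [hK]; positivity
  refine ⟨C₀ * K, mul_pos hC₀ hKpos, ?_⟩
  set α : ℝ := 5 * 2 ^ k * Real.log k / k with hαdef
  have hα : 0 ≤ α := by
    rw [hαdef]
    exact div_nonneg (mul_nonneg (by positivity) (Real.log_natCast_nonneg k)) (Nat.cast_nonneg k)
  have hev := hmain (fun n : ℕ => (2 * k + k * k * (6 * Real.log n + 1)) ^ 2 + 1) (shwLoc_isLittleO k)
  have hlargeE : ∀ᶠ n : ℕ in atTop, Real.exp (α * k * Real.exp 2) ≤ (n : ℝ) ^ 3 :=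
    ((tendsto_pow_atTop (by norm_num : (3 : ℕ) ≠ 0)).comp tendsto_natCast_atTop_atTop).eventually_ge_atTop _
  filter_upwards [hev, hlargeE, eventually_ge_atTop 3] with n hn hlarge hn3 m hm g hloc
  have hn1 : 1 ≤ n := le_trans (by norm_num) hn3
  have hn3R : (3 : ℝ) ≤ n := by exact_mod_cast hn3
  have hnpos : (0 : ℝ) < n := by linarith only [hn3R]
  have hm_le : (m : ℝ) ≤ α * n := by rw [hm]; exact Nat.floor_le (by positivity)
  have hS := shwLoc_twoRound_meanSquare hn1 α hα hm_le hlarge g hloc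
  have hs0 : (0 : ℝ) ≤ (2 * k + k * k * (6 * Real.log n + 1)) ^ 2 + 1 := by positivity
  have hle := hn m hm g hs0 hS
  -- `1 + log² n · s₂(n) ≤ K log⁴ n`
  have hL1 : 1 ≤ Real.log n := by
    rw [← Real.log_exp 1]
    apply Real.log_le_log (Real.exp_pos 1)
    have : Real.exp 1 ≤ 3 := le_of_lt (lt_trans Real.exp_one_lt_d9 (by norm_num))
    exact this.trans hn3R
  set L := Real.log n with hL
  have hbase0 : 0 ≤ 2 * k + k * k * (6 * L + 1) := by
    have : 0 ≤ L := by linarith only [hL1]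
    positivity
  have hbase : 2 * k + k * k * (6 * L + 1) ≤ (2 * k + 7 * (k * k)) * L := by
    have : 0 ≤ (2 * k + k * k) * (L - 1) := mul_nonneg (by positivity) (by linarith only [hL1])
    nlinarith only [this]
  have hsq : (2 * k + k * k * (6 * L + 1)) ^ 2 ≤ ((2 * k + 7 * (k * k)) * L) ^ 2 :=
    pow_le_pow_left₀ hbase0 hbase 2
  have hL2 : 1 ≤ L ^ 2 := one_le_pow₀ hL1
  have hL4 : 1 ≤ L ^ 4 := one_le_pow₀ hL1
  have hpoly : 1 + L ^ 2 * ((2 * k + k * k * (6 * L + 1)) ^ 2 + 1) ≤ K * L ^ 4 := by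
    have hL2nn : 0 ≤ L ^ 2 := by positivity
    have h1 : L ^ 2 * ((2 * k + k * k * (6 * L + 1)) ^ 2 + 1)
        ≤ L ^ 2 * (((2 * k + 7 * (k * k)) * L) ^ 2 + L ^ 2) := by
      apply mul_le_mul_of_nonneg_left _ hL2nn
      linarith only [hsq, hL2]
    have h2 : L ^ 2 * (((2 * k + 7 * (k * k)) * L) ^ 2 + L ^ 2) = ((2 * k + 7 * (k * k)) ^ 2 + 1) * L ^ 4 := by
      ring
    rw [hK]
    linarith only [h1, h2, hL4]
  have hNnn : (0 : ℝ) ≤ Fintype.card (Fin m → Fin k → Fin n × Bool) := Nat.cast_nonneg _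
  calc ((Finset.univ.filter fun Φ : Fin m → Fin k → Fin n × Bool =>
        ∀ i, ∃ j, g Φ (Φ i j).1 = (Φ i j).2).card : ℝ)
      ≤ C₀ * (1 + L ^ 2 * ((2 * k + k * k * (6 * L + 1)) ^ 2 + 1)) / n
          * Fintype.card (Fin m → Fin k → Fin n × Bool) := hle
    _ ≤ C₀ * (K * L ^ 4) / n * Fintype.card (Fin m → Fin k → Fin n × Bool) := by
        apply mul_le_mul_of_nonneg_right _ hNnn
        apply div_le_div_of_nonneg_right _ hnpos.le
        exact mul_le_mul_of_nonneg_left hpoly hC₀.le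
    _ = C₀ * K * L ^ 4 / n * Fintype.card (Fin m → Fin k → Fin n × Bool) := by ring

/-- **Two-round local solvers give stable sections (the transfer, instantiated).** For every `k ≥ 1`,
`α, η, ν, ε > 0`: if, for infinitely many `n` (`m = ⌊αn⌋₊`), some two-round local search map solves at
least an `ε`-fraction of `F_k(n, m)`, then for every `c > 0`, infinitely often, some map is `νm`-valid
at every splice point of the Bresler–Huang path and `ηn`-stable between consecutive ones on at least
`e^{-cn}·#paths` of the path tuples — the conclusion of `SolvableImpliesStableSection` at `(k, α, η, ν)`. -/
theorem shwLoc_twoRound_stableSection_of_solvable (k : ℕ) (hk : 1 ≤ k) (α η ν : ℝ) (hα : 0 < α)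
    (hη : 0 < η) (hν : 0 < ν) (ε : ℝ) (hε : 0 < ε)
    (hsolv : ∃ᶠ n : ℕ in atTop, ∀ m : ℕ, m = ⌊α * n⌋₊ →
      ∃ g : (Fin m → Fin k → Fin n × Bool) → (Fin n → Bool),
        (∀ (Φ Φ' : Fin m → Fin k → Fin n × Bool) (v : Fin n),
          (∀ i : Fin m,
            ((∃ j : Fin k, ((Φ i j).1 = v ∨
                ∃ i' : Fin m, (∃ j', (Φ i' j').1 = v) ∧ ∃ j', (Φ i' j').1 = (Φ i j).1)) ∨
             (∃ j : Fin k, ((Φ' i j).1 = v ∨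
                ∃ i' : Fin m, (∃ j', (Φ' i' j').1 = v) ∧ ∃ j', (Φ' i' j').1 = (Φ' i j).1))) →
            Φ i = Φ' i) →
          g Φ v = g Φ' v) ∧
        ε * Fintype.card (Fin m → Fin k → Fin n × Bool) ≤
          ((Finset.univ.filter fun Φ : Fin m → Fin k → Fin n × Bool =>
            ∀ i, ∃ j, g Φ (Φ i j).1 = (Φ i j).2).card : ℝ))
    (c : ℝ) (hc : 0 < c) :
    ∃ᶠ n : ℕ in atTop, ∀ m : ℕ, m = ⌊α * n⌋₊ →
      ∃ g : (Fin m → Fin k → Fin n × Bool) → (Fin n → Bool),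
        Real.exp (-(c * n)) * Fintype.card (Fin (k + 1) → Fin m → Fin k → Fin n × Bool) ≤
        ((Finset.univ.filter fun Ψ : Fin (k + 1) → Fin m → Fin k → Fin n × Bool =>
          let P : Fin k → ℕ → Fin m → Fin k → Fin n × Bool :=
            fun r q a b => if (a : ℕ) * k + b < q then Ψ r.succ a b else Ψ r.castSucc a b
          (∀ r : Fin k, ∀ q ≤ m * k, ((Finset.univ.filter fun i : Fin m =>
            ∀ j, g (P r q) (P r q i j).1 ≠ (P r q i j).2).card : ℝ) ≤ ν * m) ∧
          ∀ r : Fin k, ∀ q < m * k,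
            (hammingDist (g (P r q)) (g (P r (q + 1))) : ℝ) ≤ η * n).card : ℝ) := by
  refine sissMS_concl_of_meanSquareStableSolver k hk α η ν hα hη hν
    (fun n : ℕ => (2 * k + k * k * (6 * Real.log n + 1)) ^ 2 + 1) (shwLoc_isLittleO k) ε hε ?_ c hc
  have hlargeE : ∀ᶠ n : ℕ in atTop, Real.exp (α * k * Real.exp 2) ≤ (n : ℝ) ^ 3 :=
    ((tendsto_pow_atTop (by norm_num : (3 : ℕ) ≠ 0)).comp tendsto_natCast_atTop_atTop).eventually_ge_atTop _
  refine (hsolv.and_eventually (hlargeE.and (eventually_ge_atTop 1))).mono ?_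
  rintro n ⟨hn, hlarge, hn1⟩ m hm
  obtain ⟨g, hloc, hsucc⟩ := hn m hm
  have hm_le : (m : ℝ) ≤ α * n := by rw [hm]; exact Nat.floor_le (by positivity)
  exact ⟨g, shwLoc_twoRound_meanSquare hn1 α hα.le hm_le hlarge g hloc, hsucc⟩

end TwoRoundRung

end Summit.PneNP.PneNP.Theorems
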